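/-
Copyright (c) 2026 the pub-hodgecm-mathlib formalisation cell (harness21).  Prover seat hodgecm-mathlib-K2E4-p07 (g4) (road (d-w) of ‹J3› v2, owner K2E3-p03 (g3);
(C2b-i) «TOP INDEX», FILE B2): the unit index `[𝒪^× : Λ^×] = (q+1)·q^{d−2}` of the wild quaternion order and its norm-one form `[D¹ : Λ¹]`.  2026-09-04.
-/
import Summits.HodgeConjecture.HodgeConjecture.Theorems.K2E3WildQuaternionUnitClasses   -- ★ FILE B1 p857200 (this seat): `relIndex_add_relIndex_eq_of_units_ring`, boxes `mem_map_box_iff`, `relIndex_map_box`; brings ★ FILE A p857178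
import HarnessLib

/-!
# K2 ∕ E3, road (d-w) — (C2b-i) FILE B2 `K2E3WildQuaternionUnitIndex`: `[𝒪^× : Λ^×] = [D¹ : Λ¹] = (q+1)·q^{d−2}` for the wild quaternion model `q(a,b) = (a ξb; σb σa)`

Cell `hodgecm-mathlib` (Track B «K2-LIT»), item h413 = `stmt-HodgeConjecture-24833`; PROOF lane, `--supports stmt-HodgeConjecture-24833 --as helper`; count-neutral.  ONE-FIELD CORE of (C2b-i)
(K2E5-p07 (g3)'s cand `sig_K2E3WildAnisoTopIndex` = ★ p857155's `hTop`; FILE C dresses it on the CM carrier).  Datum `IsRamifiedQuadraticDatum σ ϖ d t`, `K = E` complete with finite residue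
field, WILD (`|2| < 1`), `ξ` a fixed unit non-norm; `𝒪^× = {q(a,b) : |N a − ξ N b| = 1}`, `Λ^× = {…, a, b ∈ 𝒪_E}`, `D¹ = {N a − ξ N b = 1}`, `Λ¹ = D¹ ∩ Λ^×` — hypothesis-characterised subgroups of
`GL₂(E)` (existence: `exists_unitGroup`, `exists_intUnitGroup`, `exists_normOneGroups`).  §1 the groups and their membership against the boxes of ★ FILE B1 (`𝒪^× ↔ 𝒪 ∖ 𝔓`, `Λ^× ↔ Λ ∖ (Λ ∩ 𝔓)`,
`𝒪^×·𝔓^{d−1} ⊆ 𝔓^{d−1}`, `𝒪^× ∩ (1 + 𝔓^{d−1}) ⊆ Λ^×`).  §2 THE COUNT **`relIndex_intUnitGroup_unitGroup`: `[𝒪^× : Λ^×] = (q+1)·q^{d−2}`** — ★ B1 `relIndex_add_relIndex_eq_of_units_ring` twice with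
`V = 𝒪^× ∩ (1 + 𝔓^{d−1})`: `[𝒪^× : V] = q^{2d−2} − q^{2d−4}`, `[Λ^× : V] = q^{d−1} − q^{d−2}` (★ B1 `relIndex_map_box`), then `Subgroup.relIndex_mul_relIndex`.  §3 NORM ONE **`relIndex_normOne_eq`:
`[D¹ : Λ¹] = (q+1)·q^{d−2}`** — `nrd(Λ^×) = nrd(𝒪^×)` (★ FILE A `exists_integral_norm_sub_mul_norm_eq`) ⇒ `𝒪^× ⊆ D¹·Λ^×` ⇒ ★ `relIndex_eq_relIndex_of_coe_subset_mul`; `D¹`, `Λ¹` stated as the RHS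
of ★ `mem_unitaryGroupOfForm_and_det_eq_one_iff`, so FILE C only transports along ★ `localNonsplitEquiv`.  [cite: Serre1979, Ch. IV §2 Prop. 6; Ch. V §3 Cor. 3] [cite: VignerasLNM800, Ch. II §1, §4]
[cite: Kottwitz1988, §2 Thm. 2]  HONEST LABEL: HC_CM is proved only modulo the 7 printed citations (2 remaining named inputs: hLiu418 = stmt-HodgeConjecture-24832, h413 = stmt-HodgeConjecture-24833)
until rung 0 closes; (W3)∕(C2) NOT proved here; count-neutral.

## References
* [Serre1979] J.-P. Serre, *Local Fields*, GTM 67 (1979) — Ch. IV §2, Ch. V §3.  * [VignerasLNM800] M.-F. Vignéras, LNM 800 (1980) — Ch. II §1, §4.  * [Kottwitz1988] R. Kottwitz, *Tamagawa numbers* (1988) — §2.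
-/

set_option autoImplicit false
set_option linter.dupNamespace false

noncomputable section

namespace Summit.HodgeConjecture.HodgeConjecture.Cruxes.H413.K2E3WildQuaternionUnitIndex

open WithZero
open scoped Valued Matrix MatrixGroups Pointwise
open Literature.NumberTheory.Automorphic Literature.NumberTheory.Automorphic.UnitaryGroup
open Literature.NumberTheory.Automorphic.UnitaryThreeFourFrame (IsRamifiedQuadraticDatum)
open Literature.NumberTheory.LocalFields.WildQuadraticDatum
open Summit.HodgeConjecture.HodgeConjecture.Cruxes.H413.K2E3WildQuaternionOrder
open Summit.HodgeConjecture.HodgeConjecture.Cruxes.H413.K2E3WildQuaternionUnitClasses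

section Datum

variable {K : Type} [Field K] [Valued K ℤᵐ⁰] {σ : K →+* K} {ϖ : K} {d t : ℕ}

/-! ## §1 The unit groups `𝒪^×`, `Λ^×` of the model inside `GL₂(E)` -/

omit [Valued K ℤᵐ⁰] in
/-- **The inverse in the model**: `q(σa∕δ, −b∕δ) · q(a, b) = 1`, `δ = N a − ξ N b ≠ 0`. [cite: VignerasLNM800, Ch. II §1] -/
theorem quatMat_inv_mul (hσ : ∀ x, σ (σ x) = x) {ξ : K} (hσξ : σ ξ = ξ) {a b : K} (hδ : a * σ a - ξ * (b * σ b) ≠ 0) :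
    !![σ a / (a * σ a - ξ * (b * σ b)), ξ * (-b / (a * σ a - ξ * (b * σ b))); σ (-b / (a * σ a - ξ * (b * σ b))), σ (σ a / (a * σ a - ξ * (b * σ b)))] *
        !![a, ξ * b; σ b, σ a] = 1 := by
  rw [quatMat_mul σ ξ hσ hσξ, ← quatMat_one σ ξ]
  have h1 : σ a / (a * σ a - ξ * (b * σ b)) * a + ξ * (-b / (a * σ a - ξ * (b * σ b)) * σ b) = 1 := by
    have e : σ a / (a * σ a - ξ * (b * σ b)) * a + ξ * (-b / (a * σ a - ξ * (b * σ b)) * σ b) =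
        (a * σ a - ξ * (b * σ b)) / (a * σ a - ξ * (b * σ b)) := by ring
    rw [e, div_self hδ]
  have h2 : σ a / (a * σ a - ξ * (b * σ b)) * b + -b / (a * σ a - ξ * (b * σ b)) * σ a = 0 := by ring
  rw [h1, h2]

omit [Valued K ℤᵐ⁰] in
/-- The reduced norm of the inverse coordinates: `N(σa∕δ) − ξ N(−b∕δ) = δ⁻¹`. [cite: VignerasLNM800, Ch. II §1] -/
theorem norm_inv_coords (hσ : ∀ x, σ (σ x) = x) {ξ : K} (hσξ : σ ξ = ξ) {a b : K} (hδ : a * σ a - ξ * (b * σ b) ≠ 0) :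
    σ a / (a * σ a - ξ * (b * σ b)) * σ (σ a / (a * σ a - ξ * (b * σ b))) -
        ξ * (-b / (a * σ a - ξ * (b * σ b)) * σ (-b / (a * σ a - ξ * (b * σ b)))) = (a * σ a - ξ * (b * σ b))⁻¹ := by
  rw [map_div₀, map_div₀, hσ, map_norm_sub_mul_norm hσ hσξ a b, map_neg]
  have e' : σ a / (a * σ a - ξ * (b * σ b)) * (a / (a * σ a - ξ * (b * σ b))) - ξ * (-b / (a * σ a - ξ * (b * σ b)) * (-σ b / (a * σ a - ξ * (b * σ b)))) =
      (a * σ a - ξ * (b * σ b)) * ((a * σ a - ξ * (b * σ b))⁻¹ * (a * σ a - ξ * (b * σ b))⁻¹) := by ring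
  rw [e', ← mul_assoc, mul_inv_cancel₀ hδ, one_mul]

/-- **`𝒪^×` EXISTS AS A SUBGROUP OF `GL₂(E)`**: `{g : ↑g = q(a,b), |N a − ξ N b| = 1}` is closed under products (★ `quatMat_mul`, ★ `norm_sub_mul_norm_quatMul`) and inverses (`q(a,b)⁻¹ = q(σa∕δ, −b∕δ)`).
[cite: VignerasLNM800, Ch. II §1] -/
theorem exists_unitGroup (hσ : ∀ x, σ (σ x) = x) {ξ : K} (hσξ : σ ξ = ξ) :
    ∃ UO : Subgroup (GL (Fin 2) K), ∀ g : GL (Fin 2) K, g ∈ UO ↔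
      ∃ a b : K, (g : Matrix (Fin 2) (Fin 2) K) = !![a, ξ * b; σ b, σ a] ∧ Valued.v (a * σ a - ξ * (b * σ b)) = 1 := by
  refine ⟨{ carrier := {g | ∃ a b : K, (g : Matrix (Fin 2) (Fin 2) K) = !![a, ξ * b; σ b, σ a] ∧ Valued.v (a * σ a - ξ * (b * σ b)) = 1}
            mul_mem' := ?_, one_mem' := ?_, inv_mem' := ?_ }, fun g => Iff.rfl⟩
  · rintro g g' ⟨a, b, hg, hN⟩ ⟨a', b', hg', hN'⟩
    refine ⟨a * a' + ξ * (b * σ b'), a * b' + b * σ a', ?_, ?_⟩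
    · rw [Units.val_mul, hg, hg', quatMat_mul σ ξ hσ hσξ]
    · rw [norm_sub_mul_norm_quatMul hσ hσξ, map_mul, hN, hN', mul_one]
  · exact ⟨1, 0, (quatMat_one σ ξ).symm, by rw [map_one, map_zero, mul_zero, mul_zero, sub_zero, mul_one, map_one]⟩
  · rintro g ⟨a, b, hg, hN⟩
    have hδ : a * σ a - ξ * (b * σ b) ≠ 0 := fun h0 => by rw [h0, map_zero] at hN; exact zero_ne_one hN
    refine ⟨σ a / (a * σ a - ξ * (b * σ b)), -b / (a * σ a - ξ * (b * σ b)), ?_, ?_⟩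
    · rw [Matrix.coe_units_inv, hg]
      exact Matrix.inv_eq_left_inv (quatMat_inv_mul hσ hσξ hδ)
    · rw [norm_inv_coords hσ hσξ hδ, map_inv₀, hN, inv_one]

/-- **`Λ^×` EXISTS AS A SUBGROUP OF `GL₂(E)`**: the integral elements of `𝒪^×` (`|a|, |b| ≤ 1`; the inverse `q(σa∕δ, −b∕δ)` is integral as `|δ| = 1`). [cite: VignerasLNM800, Ch. II §4] -/
theorem exists_intUnitGroup (hσ : ∀ x, σ (σ x) = x) (hvσ : ∀ a, Valued.v (σ a) = Valued.v a) {ξ : K} (hσξ : σ ξ = ξ) (hξ1 : Valued.v ξ = 1) :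
    ∃ UΛ : Subgroup (GL (Fin 2) K), ∀ g : GL (Fin 2) K, g ∈ UΛ ↔
      ∃ a b : K, (g : Matrix (Fin 2) (Fin 2) K) = !![a, ξ * b; σ b, σ a] ∧ Valued.v (a * σ a - ξ * (b * σ b)) = 1 ∧ Valued.v a ≤ 1 ∧ Valued.v b ≤ 1 := by
  refine ⟨{ carrier := {g | ∃ a b : K, (g : Matrix (Fin 2) (Fin 2) K) = !![a, ξ * b; σ b, σ a] ∧ Valued.v (a * σ a - ξ * (b * σ b)) = 1 ∧ Valued.v a ≤ 1 ∧ Valued.v b ≤ 1}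
            mul_mem' := ?_, one_mem' := ?_, inv_mem' := ?_ }, fun g => Iff.rfl⟩
  · rintro g g' ⟨a, b, hg, hN, ha, hb⟩ ⟨a', b', hg', hN', ha', hb'⟩
    refine ⟨a * a' + ξ * (b * σ b'), a * b' + b * σ a', ?_, ?_, ?_, ?_⟩
    · rw [Units.val_mul, hg, hg', quatMat_mul σ ξ hσ hσξ]
    · rw [norm_sub_mul_norm_quatMul hσ hσξ, map_mul, hN, hN', mul_one]
    · refine (Valuation.map_add _ _ _).trans (max_le ?_ ?_)
      · rw [map_mul]; exact mul_le_one' ha ha'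
      · rw [map_mul, map_mul, hξ1, one_mul, hvσ]; exact mul_le_one' hb hb'
    · refine (Valuation.map_add _ _ _).trans (max_le ?_ ?_)
      · rw [map_mul]; exact mul_le_one' ha hb'
      · rw [map_mul, hvσ]; exact mul_le_one' hb ha'
  · exact ⟨1, 0, (quatMat_one σ ξ).symm, by rw [map_one, map_zero, mul_zero, mul_zero, sub_zero, mul_one, map_one], by rw [map_one], by rw [map_zero]; exact zero_le_one⟩
  · rintro g ⟨a, b, hg, hN, ha, hb⟩
    have hδ : a * σ a - ξ * (b * σ b) ≠ 0 := fun h0 => by rw [h0, map_zero] at hN; exact zero_ne_one hN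
    refine ⟨σ a / (a * σ a - ξ * (b * σ b)), -b / (a * σ a - ξ * (b * σ b)), ?_, ?_, ?_, ?_⟩
    · rw [Matrix.coe_units_inv, hg]
      exact Matrix.inv_eq_left_inv (quatMat_inv_mul hσ hσξ hδ)
    · rw [norm_inv_coords hσ hσξ hδ, map_inv₀, hN, inv_one]
    · rw [map_div₀, hN, div_one, hvσ]; exact ha
    · rw [map_div₀, hN, div_one, Valuation.map_neg]; exact hb

/-- **`D¹` and `Λ¹` EXIST AS SUBGROUPS OF `GL₂(E)`**: `D¹ = 𝒪^× ∩ ker det = {q(a,b) : N a − ξ N b = 1}`, `Λ¹ = Λ^× ∩ ker det`. [cite: VignerasLNM800, Ch. II §1] -/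
theorem exists_normOneGroups (hσ : ∀ x, σ (σ x) = x) (hvσ : ∀ a, Valued.v (σ a) = Valued.v a) {ξ : K} (hσξ : σ ξ = ξ) (hξ1 : Valued.v ξ = 1) :
    (∃ SU : Subgroup (GL (Fin 2) K), ∀ g : GL (Fin 2) K, g ∈ SU ↔
      ∃ a b : K, (g : Matrix (Fin 2) (Fin 2) K) = !![a, ξ * b; σ b, σ a] ∧ a * σ a - ξ * (b * σ b) = 1) ∧
    (∃ SK : Subgroup (GL (Fin 2) K), ∀ g : GL (Fin 2) K, g ∈ SK ↔
      ∃ a b : K, (g : Matrix (Fin 2) (Fin 2) K) = !![a, ξ * b; σ b, σ a] ∧ a * σ a - ξ * (b * σ b) = 1 ∧ Valued.v a ≤ 1 ∧ Valued.v b ≤ 1) := by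
  obtain ⟨UO, hUO⟩ := exists_unitGroup hσ hσξ
  obtain ⟨UΛ, hUΛ⟩ := exists_intUnitGroup hσ hvσ hσξ hξ1
  refine ⟨⟨UO ⊓ (Matrix.GeneralLinearGroup.det).ker, fun g => ?_⟩, ⟨UΛ ⊓ (Matrix.GeneralLinearGroup.det).ker, fun g => ?_⟩⟩
  · rw [Subgroup.mem_inf, MonoidHom.mem_ker, hUO, Units.ext_iff, Matrix.GeneralLinearGroup.val_det_apply, Units.val_one]
    constructor
    · rintro ⟨⟨a, b, hg, -⟩, hdet⟩; exact ⟨a, b, hg, by rwa [hg, det_quatMat σ ξ] at hdet⟩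
    · rintro ⟨a, b, hg, hN⟩; exact ⟨⟨a, b, hg, by rw [hN, map_one]⟩, by rw [hg, det_quatMat σ ξ, hN]⟩
  · rw [Subgroup.mem_inf, MonoidHom.mem_ker, hUΛ, Units.ext_iff, Matrix.GeneralLinearGroup.val_det_apply, Units.val_one]
    constructor
    · rintro ⟨⟨a, b, hg, -, ha, hb⟩, hdet⟩; exact ⟨a, b, hg, by rwa [hg, det_quatMat σ ξ] at hdet, ha, hb⟩
    · rintro ⟨a, b, hg, hN, ha, hb⟩; exact ⟨⟨a, b, hg, by rw [hN, map_one], ha, hb⟩, by rw [hg, det_quatMat σ ξ, hN]⟩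

/-! ### The model is injective; σ-fixed elements between two even levels are units -/

omit [Valued K ℤᵐ⁰] in
/-- `q(a,b) = q(a′,b′) ⟹ a = a′ ∧ b = b′` (entries `(0,0)` and `(1,0)`, `σ` injective). [cite: VignerasLNM800, Ch. II §1] -/
theorem quatMat_inj {ξ a b a' b' : K} (h : !![a, ξ * b; σ b, σ a] = !![a', ξ * b'; σ b', σ a']) : a = a' ∧ b = b' := by
  have h00 : !![a, ξ * b; σ b, σ a] 0 0 = !![a', ξ * b'; σ b', σ a'] 0 0 := by rw [h]
  have h10 : !![a, ξ * b; σ b, σ a] 1 0 = !![a', ξ * b'; σ b', σ a'] 1 0 := by rw [h]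
  simp only [Matrix.of_apply, Matrix.cons_val', Matrix.cons_val_zero, Matrix.cons_val_one, Matrix.cons_val_fin_one] at h00 h10
  exact ⟨h00, σ.injective h10⟩

/-- **Parity**: a `σ`-fixed `δ` with `|δ| ≤ 1` and `¬ |δ| ≤ q⁻²` is a unit (fixed non-zero elements have even valuation). [cite: Serre1979, Ch. V §3 Cor. 3] -/
theorem v_eq_one_of_le_of_not_le (hD : IsRamifiedQuadraticDatum σ ϖ d t) {δ : K} (hσδ : σ δ = δ)
    (h0 : Valued.v δ ≤ exp (2 * (0 : ℤ))) (h1 : ¬ Valued.v δ ≤ exp (2 * (-1 : ℤ))) : Valued.v δ = 1 := by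
  obtain ⟨-, -, -, hfix, -, -, -⟩ := hD
  have hδ0 : δ ≠ 0 := fun h => h1 (by rw [h, map_zero]; exact zero_le)
  obtain ⟨m, hm⟩ := hfix δ hσδ hδ0
  rw [hm, exp_le_exp] at h0 h1
  rw [hm, ← exp_zero]; congr 1; omega

/-! ### `𝒪^× = 𝒪 ∖ 𝔓` and `Λ^× = Λ ∖ (Λ ∩ 𝔓)` against the boxes of ★ FILE B1 -/

/-- **`𝒪^× = 𝒪 ∖ 𝔓`**: `x` is (the matrix of) an element of `𝒪^×` iff `x ∈ Φ(B(1) × B(e^{d−1})) = 𝒪` and `x ∉ Φ(B(e^{−1}) × B(e^{d−2})) = 𝔓`. [cite: VignerasLNM800, Ch. II §1] -/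
theorem exists_mem_unitGroup_iff [CompleteSpace K] (hD : IsRamifiedQuadraticDatum σ ϖ d t)
    {ξ : K} (hσξ : σ ξ = ξ) (hξ1 : Valued.v ξ = 1) (hξN : ¬ ∃ z : K, z * σ z = ξ)
    {e₀ : K} (he₀1 : Valued.v e₀ ≤ 1) (he₀ : Valued.v (ξ - e₀ * σ e₀) ≤ exp (-(2 * ((d - 1 : ℕ) : ℤ))))
    (Φ : K × K →+ Matrix (Fin 2) (Fin 2) K) (hΦ : ∀ c b : K, Φ (c, b) = !![c - b * e₀, ξ * b; σ b, σ (c - b * e₀)])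
    (UO : Subgroup (GL (Fin 2) K)) (hUO : ∀ g : GL (Fin 2) K, g ∈ UO ↔
      ∃ a b : K, (g : Matrix (Fin 2) (Fin 2) K) = !![a, ξ * b; σ b, σ a] ∧ Valued.v (a * σ a - ξ * (b * σ b)) = 1) (x : Matrix (Fin 2) (Fin 2) K) :
    (∃ u : GL (Fin 2) K, u ∈ UO ∧ (u : Matrix (Fin 2) (Fin 2) K) = x) ↔
      (x ∈ (((Valued.v : Valuation K ℤᵐ⁰).leAddSubgroup (exp 0)).prod ((Valued.v : Valuation K ℤᵐ⁰).leAddSubgroup (exp ((d - 1 : ℕ) : ℤ)))).map Φ ∧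
        x ∉ (((Valued.v : Valuation K ℤᵐ⁰).leAddSubgroup (exp (-1 : ℤ))).prod
          ((Valued.v : Valuation K ℤᵐ⁰).leAddSubgroup (exp (-1 + ((d - 1 : ℕ) : ℤ))))).map Φ) := by
  obtain ⟨hσ, -, -, -, -, -, -⟩ := id hD
  have h0 := mem_map_box_iff hD hσξ hξ1 hξN he₀1 he₀ Φ hΦ 0 x
  rw [zero_add] at h0
  rw [h0, mem_map_box_iff hD hσξ hξ1 hξN he₀1 he₀ Φ hΦ (-1) x]
  constructor
  · rintro ⟨u, hu, rfl⟩
    obtain ⟨a, b, hg, hN⟩ := (hUO u).1 hu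
    refine ⟨⟨a, b, hg, by rw [hN, mul_zero, exp_zero]⟩, ?_⟩
    rintro ⟨a', b', hg', hN'⟩
    obtain ⟨rfl, rfl⟩ := quatMat_inj (σ := σ) (hg.symm.trans hg')
    rw [hN, ← exp_zero, exp_le_exp] at hN'
    omega
  · rintro ⟨⟨a, b, rfl, hN⟩, hnot⟩
    have hN1 : Valued.v (a * σ a - ξ * (b * σ b)) = 1 :=
      v_eq_one_of_le_of_not_le hD (map_norm_sub_mul_norm hσ hσξ a b) hN fun h => hnot ⟨a, b, rfl, h⟩
    have hdet : (!![a, ξ * b; σ b, σ a]).det ≠ 0 := by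
      rw [det_quatMat σ ξ]; intro h0'; rw [h0', map_zero] at hN1; exact zero_ne_one hN1
    exact ⟨Matrix.GeneralLinearGroup.mkOfDetNeZero _ hdet,
      (hUO _).2 ⟨a, b, Matrix.GeneralLinearGroup.val_mkOfDetNeZero _ _, hN1⟩, Matrix.GeneralLinearGroup.val_mkOfDetNeZero _ _⟩

/-- **`Λ^× = Λ ∖ (Λ ∩ 𝔓)`** (WILD, `d ≥ 2`): `x` is an element of `Λ^×` iff `x ∈ Φ(B(1) × B(1)) = Λ` and `x ∉ Φ(B(e^{−1}) × B(1)) = Λ ∩ 𝔓`. [cite: VignerasLNM800, Ch. II §4] -/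
theorem exists_mem_intUnitGroup_iff [CompleteSpace K] (hD : IsRamifiedQuadraticDatum σ ϖ d t) (h2 : Valued.v (2 : K) < 1)
    {ξ : K} (hσξ : σ ξ = ξ) (hξ1 : Valued.v ξ = 1) (hξN : ¬ ∃ z : K, z * σ z = ξ)
    {e₀ : K} (he₀1 : Valued.v e₀ ≤ 1) (he₀ : Valued.v (ξ - e₀ * σ e₀) ≤ exp (-(2 * ((d - 1 : ℕ) : ℤ))))
    (Φ : K × K →+ Matrix (Fin 2) (Fin 2) K) (hΦ : ∀ c b : K, Φ (c, b) = !![c - b * e₀, ξ * b; σ b, σ (c - b * e₀)])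
    (UΛ : Subgroup (GL (Fin 2) K)) (hUΛ : ∀ g : GL (Fin 2) K, g ∈ UΛ ↔
      ∃ a b : K, (g : Matrix (Fin 2) (Fin 2) K) = !![a, ξ * b; σ b, σ a] ∧ Valued.v (a * σ a - ξ * (b * σ b)) = 1 ∧ Valued.v a ≤ 1 ∧ Valued.v b ≤ 1)
    (x : Matrix (Fin 2) (Fin 2) K) :
    (∃ u : GL (Fin 2) K, u ∈ UΛ ∧ (u : Matrix (Fin 2) (Fin 2) K) = x) ↔
      (x ∈ (((Valued.v : Valuation K ℤᵐ⁰).leAddSubgroup (exp 0)).prod ((Valued.v : Valuation K ℤᵐ⁰).leAddSubgroup (exp 0))).map Φ ∧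
        x ∉ (((Valued.v : Valuation K ℤᵐ⁰).leAddSubgroup (exp (-1 : ℤ))).prod ((Valued.v : Valuation K ℤᵐ⁰).leAddSubgroup (exp 0))).map Φ) := by
  obtain ⟨hσ, -, -, -, -, -, -⟩ := id hD
  have hd2 := K2E3WildAnisotropicPlaneNonIntegral.two_le_d_of_valued_two_lt_one hD h2
  rw [mem_map_intBox_iff Φ hΦ 0 x, mem_map_intBox_iff Φ hΦ (-1) x]
  constructor
  · rintro ⟨u, hu, rfl⟩
    obtain ⟨a, b, hg, hN, ha, hb⟩ := (hUΛ u).1 hu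
    refine ⟨⟨a, b, hg, by rw [exp_zero]; exact (v_add_mul_le_one_iff he₀1 hb).2 ha, hb⟩, ?_⟩
    rintro ⟨a', b', hg', hc', -⟩
    obtain ⟨rfl, rfl⟩ := quatMat_inj (σ := σ) (hg.symm.trans hg')
    have hb' : Valued.v b ≤ exp (-1 + ((d - 1 : ℕ) : ℤ)) := hb.trans (by rw [← exp_zero, exp_le_exp]; omega)
    have key := v_norm_sub_mul_norm_le_of_coords hD he₀1 he₀ hc' hb'
    rw [add_sub_cancel_right, hN, ← exp_zero, exp_le_exp] at key
    omega
  · rintro ⟨⟨a, b, rfl, hc, hb⟩, hnot⟩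
    have ha : Valued.v a ≤ 1 := (v_add_mul_le_one_iff he₀1 hb).1 (by rwa [exp_zero] at hc)
    have hN0 : Valued.v (a * σ a - ξ * (b * σ b)) ≤ exp (2 * (0 : ℤ)) := by
      have hb' : Valued.v b ≤ exp (0 + ((d - 1 : ℕ) : ℤ)) := hb.trans (by rw [← exp_zero, exp_le_exp]; omega)
      have key := v_norm_sub_mul_norm_le_of_coords hD he₀1 he₀ hc hb'
      rwa [add_sub_cancel_right] at key
    have hN1 : Valued.v (a * σ a - ξ * (b * σ b)) = 1 := by
      refine v_eq_one_of_le_of_not_le hD (map_norm_sub_mul_norm hσ hσξ a b) hN0 fun h => hnot ⟨a, b, rfl, ?_, hb⟩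
      exact (coords_of_v_norm_sub_mul_norm_le hD hσξ hξ1 hξN he₀ h).2
    have hdet : (!![a, ξ * b; σ b, σ a]).det ≠ 0 := by
      rw [det_quatMat σ ξ]; intro h0'; rw [h0', map_zero] at hN1; exact zero_ne_one hN1
    exact ⟨Matrix.GeneralLinearGroup.mkOfDetNeZero _ hdet,
      (hUΛ _).2 ⟨a, b, Matrix.GeneralLinearGroup.val_mkOfDetNeZero _ _, hN1, ha, hb⟩, Matrix.GeneralLinearGroup.val_mkOfDetNeZero _ _⟩

/-- **`𝒪^× · 𝔓^{d−1} ⊆ 𝔓^{d−1}`** with `𝔓^{d−1} = Φ(B(e^{−(d−1)}) × B(1))` (the reduced norm is multiplicative). [cite: VignerasLNM800, Ch. II §1] -/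
theorem unitGroup_mul_mem [CompleteSpace K] (hD : IsRamifiedQuadraticDatum σ ϖ d t)
    {ξ : K} (hσξ : σ ξ = ξ) (hξ1 : Valued.v ξ = 1) (hξN : ¬ ∃ z : K, z * σ z = ξ)
    {e₀ : K} (he₀1 : Valued.v e₀ ≤ 1) (he₀ : Valued.v (ξ - e₀ * σ e₀) ≤ exp (-(2 * ((d - 1 : ℕ) : ℤ))))
    (Φ : K × K →+ Matrix (Fin 2) (Fin 2) K) (hΦ : ∀ c b : K, Φ (c, b) = !![c - b * e₀, ξ * b; σ b, σ (c - b * e₀)])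
    (UO : Subgroup (GL (Fin 2) K)) (hUO : ∀ g : GL (Fin 2) K, g ∈ UO ↔
      ∃ a b : K, (g : Matrix (Fin 2) (Fin 2) K) = !![a, ξ * b; σ b, σ a] ∧ Valued.v (a * σ a - ξ * (b * σ b)) = 1) :
    ∀ u : GL (Fin 2) K, u ∈ UO → ∀ x : Matrix (Fin 2) (Fin 2) K,
      x ∈ (((Valued.v : Valuation K ℤᵐ⁰).leAddSubgroup (exp (-((d - 1 : ℕ) : ℤ)))).prod ((Valued.v : Valuation K ℤᵐ⁰).leAddSubgroup (exp 0))).map Φ →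
      (u : Matrix (Fin 2) (Fin 2) K) * x ∈
        (((Valued.v : Valuation K ℤᵐ⁰).leAddSubgroup (exp (-((d - 1 : ℕ) : ℤ)))).prod ((Valued.v : Valuation K ℤᵐ⁰).leAddSubgroup (exp 0))).map Φ := by
  obtain ⟨hσ, -, -, -, -, -, -⟩ := id hD
  intro u hu x hx
  have hC := fun y => mem_map_box_iff hD hσξ hξ1 hξN he₀1 he₀ Φ hΦ (-((d - 1 : ℕ) : ℤ)) y
  simp only [neg_add_cancel] at hC
  obtain ⟨a, b, hg, hN⟩ := (hUO u).1 hu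
  obtain ⟨a', b', rfl, hN'⟩ := (hC x).1 hx
  refine (hC _).2 ⟨a * a' + ξ * (b * σ b'), a * b' + b * σ a', by rw [hg, quatMat_mul σ ξ hσ hσξ], ?_⟩
  rw [norm_sub_mul_norm_quatMul hσ hσξ, map_mul, hN, one_mul]
  exact hN'

/-- **THE LEVEL GROUP IS INTEGRAL**: `u ∈ 𝒪^×` with `u − 1 ∈ 𝔓^{d−1}` already lies in `Λ^×` (as `1 + 𝔓^{d−1} ⊆ Λ`); so ONE level group `V = 𝒪^× ∩ (1 + 𝔓^{d−1}) = Λ^× ∩ (1 + 𝔓^{d−1})` serves both counts.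
[cite: VignerasLNM800, Ch. II §4] -/
theorem mem_unitGroup_and_sub_one_mem_iff [CompleteSpace K] (hD : IsRamifiedQuadraticDatum σ ϖ d t) (h2 : Valued.v (2 : K) < 1)
    {ξ : K} {e₀ : K} (he₀1 : Valued.v e₀ ≤ 1)
    (Φ : K × K →+ Matrix (Fin 2) (Fin 2) K) (hΦ : ∀ c b : K, Φ (c, b) = !![c - b * e₀, ξ * b; σ b, σ (c - b * e₀)])
    (UO UΛ : Subgroup (GL (Fin 2) K)) (hUO : ∀ g : GL (Fin 2) K, g ∈ UO ↔
      ∃ a b : K, (g : Matrix (Fin 2) (Fin 2) K) = !![a, ξ * b; σ b, σ a] ∧ Valued.v (a * σ a - ξ * (b * σ b)) = 1)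
    (hUΛ : ∀ g : GL (Fin 2) K, g ∈ UΛ ↔
      ∃ a b : K, (g : Matrix (Fin 2) (Fin 2) K) = !![a, ξ * b; σ b, σ a] ∧ Valued.v (a * σ a - ξ * (b * σ b)) = 1 ∧ Valued.v a ≤ 1 ∧ Valued.v b ≤ 1)
    (u : GL (Fin 2) K) :
    (u ∈ UO ∧ (u : Matrix (Fin 2) (Fin 2) K) - 1 ∈
        (((Valued.v : Valuation K ℤᵐ⁰).leAddSubgroup (exp (-((d - 1 : ℕ) : ℤ)))).prod ((Valued.v : Valuation K ℤᵐ⁰).leAddSubgroup (exp 0))).map Φ) ↔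
      (u ∈ UΛ ∧ (u : Matrix (Fin 2) (Fin 2) K) - 1 ∈
        (((Valued.v : Valuation K ℤᵐ⁰).leAddSubgroup (exp (-((d - 1 : ℕ) : ℤ)))).prod ((Valued.v : Valuation K ℤᵐ⁰).leAddSubgroup (exp 0))).map Φ) := by
  obtain ⟨hσ, -, -, -, -, -, -⟩ := id hD
  have hd2 := K2E3WildAnisotropicPlaneNonIntegral.two_le_d_of_valued_two_lt_one hD h2
  refine ⟨fun ⟨hu, hC⟩ => ⟨?_, hC⟩, fun ⟨hu, hC⟩ => ⟨?_, hC⟩⟩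
  · obtain ⟨a, b, hg, hN⟩ := (hUO u).1 hu
    obtain ⟨a', b', hg', hc', hb'⟩ := (mem_map_intBox_iff Φ hΦ (-((d - 1 : ℕ) : ℤ)) _).1 hC
    have hu1 : (u : Matrix (Fin 2) (Fin 2) K) = !![a' + 1, ξ * b'; σ b', σ (a' + 1)] := by
      rw [← sub_add_cancel (u : Matrix (Fin 2) (Fin 2) K) 1, hg', ← quatMat_one σ ξ]
      ext i j
      fin_cases i <;> fin_cases j <;> simp [map_add]
    obtain ⟨hae, hbe⟩ := quatMat_inj (σ := σ) (hg.symm.trans hu1)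
    have ha' : Valued.v a' ≤ 1 :=
      (v_add_mul_le_one_iff he₀1 hb').1 (hc'.trans (by rw [← exp_zero, exp_le_exp]; omega))
    refine (hUΛ u).2 ⟨a, b, hg, hN, ?_, hbe ▸ hb'⟩
    rw [hae]
    exact (Valuation.map_add _ _ _).trans (max_le ha' (by rw [map_one]))
  · obtain ⟨a, b, hg, hN, -, -⟩ := (hUΛ u).1 hu
    exact (hUO u).2 ⟨a, b, hg, hN⟩

/-! ## §2 THE COUNT `[𝒪^× : Λ^×] = (q+1)·q^{d−2}` -/

/-- **`[𝒪^× : Λ^×] = (q + 1)·q^{d−2}`** for the wild quaternion order (`d ≥ 2` from `|2| < 1`): ★ B1 `relIndex_add_relIndex_eq_of_units_ring` twice with the level group `V = 𝒪^× ∩ (1 + 𝔓^{d−1})` —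
`[𝒪^× : V] = [𝒪 : 𝔓^{d−1}] − [𝔓 : 𝔓^{d−1}] = q^{2d−2} − q^{2d−4}`, `[Λ^× : V] = [Λ : 𝔓^{d−1}] − [Λ ∩ 𝔓 : 𝔓^{d−1}] = q^{d−1} − q^{d−2}` (★ B1 `relIndex_map_box`) — and `[𝒪^× : V] = [𝒪^× : Λ^×]·[Λ^× : V]`.
[cite: VignerasLNM800, Ch. II §4] [cite: Serre1979, Ch. IV §2 Prop. 6] -/
theorem relIndex_intUnitGroup_unitGroup [CompleteSpace K] [Finite 𝓀[K]] (hD : IsRamifiedQuadraticDatum σ ϖ d t) (h2 : Valued.v (2 : K) < 1)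
    {ξ : K} (hσξ : σ ξ = ξ) (hξ1 : Valued.v ξ = 1) (hξN : ¬ ∃ z : K, z * σ z = ξ)
    (UO UΛ : Subgroup (GL (Fin 2) K)) (hUO : ∀ g : GL (Fin 2) K, g ∈ UO ↔
      ∃ a b : K, (g : Matrix (Fin 2) (Fin 2) K) = !![a, ξ * b; σ b, σ a] ∧ Valued.v (a * σ a - ξ * (b * σ b)) = 1)
    (hUΛ : ∀ g : GL (Fin 2) K, g ∈ UΛ ↔
      ∃ a b : K, (g : Matrix (Fin 2) (Fin 2) K) = !![a, ξ * b; σ b, σ a] ∧ Valued.v (a * σ a - ξ * (b * σ b)) = 1 ∧ Valued.v a ≤ 1 ∧ Valued.v b ≤ 1) :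
    UΛ.relIndex UO = (Nat.card 𝓀[K] + 1) * Nat.card 𝓀[K] ^ (d - 2) := by
  obtain ⟨hσ, hvσ, hϖ, -, -, -, -⟩ := id hD
  have hd2 := K2E3WildAnisotropicPlaneNonIntegral.two_le_d_of_valued_two_lt_one hD h2
  obtain ⟨e₀, he₀v, he₀⟩ := exists_unit_v_sub_mul_map_le hD h2 hσξ hξ1
  have he₀1 : Valued.v e₀ ≤ 1 := he₀v.le
  obtain ⟨Φ, hΦ⟩ := exists_coordHom σ ξ e₀
  have hC := unitGroup_mul_mem hD hσξ hξ1 hξN he₀1 he₀ Φ hΦ UO hUO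
  obtain ⟨V, hV⟩ := exists_levelSubgroup _ UO hC
  have hVΛ := fun u => (hV u).trans (mem_unitGroup_and_sub_one_mem_iff hD h2 he₀1 Φ hΦ UO UΛ hUO hUΛ u)
  have hΛO : UΛ ≤ UO := fun u hu => by obtain ⟨a, b, hg, hN, -, -⟩ := (hUΛ u).1 hu; exact (hUO u).2 ⟨a, b, hg, hN⟩
  have hVΛle : V ≤ UΛ := fun u hu => ((hVΛ u).1 hu).1
  have hmono : ∀ a₁ a₂ b₁ b₂ : ℤ, b₁ ≤ a₁ → b₂ ≤ a₂ →
      (((Valued.v : Valuation K ℤᵐ⁰).leAddSubgroup (exp b₁)).prod ((Valued.v : Valuation K ℤᵐ⁰).leAddSubgroup (exp b₂))).map Φ ≤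
        (((Valued.v : Valuation K ℤᵐ⁰).leAddSubgroup (exp a₁)).prod ((Valued.v : Valuation K ℤᵐ⁰).leAddSubgroup (exp a₂))).map Φ :=
    fun a₁ a₂ b₁ b₂ h₁ h₂ => AddSubgroup.map_mono (AddSubgroup.prod_mono
      ((Valued.v : Valuation K ℤᵐ⁰).leAddSubgroup_monotone (exp_le_exp.2 h₁)) ((Valued.v : Valuation K ℤᵐ⁰).leAddSubgroup_monotone (exp_le_exp.2 h₂)))
  have hq0 : Nat.card 𝓀[K] ≠ 0 := Nat.card_pos.ne'
  have hq2 : 2 ≤ Nat.card 𝓀[K] := by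
    have := Finite.one_lt_card (α := 𝓀[K]); omega
  have hO := relIndex_add_relIndex_eq_of_units_ring _ _ _ (hmono _ _ _ _ (by omega) (by omega)) (hmono _ _ _ _ (by omega) (by omega)) UO V
    (exists_mem_unitGroup_iff hD hσξ hξ1 hξN he₀1 he₀ Φ hΦ UO hUO) hV hC
    (by rw [relIndex_map_box hσ hϖ Φ hΦ]; exact mul_ne_zero (pow_ne_zero _ hq0) (pow_ne_zero _ hq0))
  have hΛ := relIndex_add_relIndex_eq_of_units_ring _ _ _ (hmono _ _ _ _ (by omega) le_rfl) (hmono _ _ _ _ (by omega) le_rfl) UΛ V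
    (exists_mem_intUnitGroup_iff hD h2 hσξ hξ1 hξN he₀1 he₀ Φ hΦ UΛ hUΛ) hVΛ (fun u hu => hC u (hΛO hu))
    (by rw [relIndex_map_box hσ hϖ Φ hΦ]; exact mul_ne_zero (pow_ne_zero _ hq0) (pow_ne_zero _ hq0))
  rw [relIndex_map_box hσ hϖ Φ hΦ, relIndex_map_box hσ hϖ Φ hΦ] at hO hΛ
  have hmul := Subgroup.relIndex_mul_relIndex V UΛ UO hVΛle hΛO
  have e2 : ((((d - 1 : ℕ) : ℤ)) - 0).toNat = d - 1 := by omega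
  have e3 : ((-1 : ℤ) - (-((d - 1 : ℕ) : ℤ))).toNat = d - 2 := by omega
  have e4 : ((-1 + ((d - 1 : ℕ) : ℤ)) - 0).toNat = d - 2 := by omega
  have e5 : ((0 : ℤ) - (-((d - 1 : ℕ) : ℤ))).toNat = d - 1 := by omega
  have e6 : ((0 : ℤ) - 0).toNat = 0 := by omega
  rw [e5, e2, e3, e4] at hO
  rw [e5, e6, e3, pow_zero, mul_one, mul_one] at hΛ
  -- arithmetic in `ℤ`: `[Λ^× : V]·X = [𝒪^× : V]`, `[Λ^× : V] = q^{d−1} − q^{d−2} ≠ 0`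
  have hpow : Nat.card 𝓀[K] ^ (d - 1) = Nat.card 𝓀[K] * Nat.card 𝓀[K] ^ (d - 2) := by
    rw [show d - 1 = (d - 2) + 1 by omega, pow_succ, mul_comm]
  rw [hpow] at hO hΛ
  have hVΛ0 : V.relIndex UΛ ≠ 0 := by
    intro h0
    rw [h0, zero_add] at hΛ
    have h2Q : 2 * Nat.card 𝓀[K] ^ (d - 2) ≤ Nat.card 𝓀[K] * Nat.card 𝓀[K] ^ (d - 2) := Nat.mul_le_mul_right _ hq2
    rw [← hΛ] at h2Q
    have := pow_ne_zero (d - 2) hq0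
    omega
  refine mul_left_cancel₀ hVΛ0 (hmul.trans ?_)
  have hΛz : (V.relIndex UΛ : ℤ) = Nat.card 𝓀[K] * Nat.card 𝓀[K] ^ (d - 2) - Nat.card 𝓀[K] ^ (d - 2) := by
    have := congrArg (fun n : ℕ => (n : ℤ)) hΛ; push_cast at this; linarith
  have hOz : (V.relIndex UO : ℤ) = Nat.card 𝓀[K] * Nat.card 𝓀[K] ^ (d - 2) * (Nat.card 𝓀[K] * Nat.card 𝓀[K] ^ (d - 2)) -
      Nat.card 𝓀[K] ^ (d - 2) * Nat.card 𝓀[K] ^ (d - 2) := by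
    have := congrArg (fun n : ℕ => (n : ℤ)) hO; push_cast at this; linarith
  have key : (V.relIndex UO : ℤ) = V.relIndex UΛ * ((Nat.card 𝓀[K] + 1) * Nat.card 𝓀[K] ^ (d - 2)) := by
    rw [hOz, hΛz]; ring
  exact_mod_cast key

/-! ## §3 NORM ONE: `[D¹ : Λ¹] = [𝒪^× : Λ^×]` -/

/-- **`[D¹ : Λ¹] = (q + 1)·q^{d−2}`** — the ONE-FIELD CORE of (C2b-i): `nrd(Λ^×) = nrd(𝒪^×)` (★ FILE A `exists_integral_norm_sub_mul_norm_eq`: every fixed unit is the reduced norm of an INTEGRAL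
element) gives `𝒪^× ⊆ D¹·Λ^×`, so ★ `relIndex_eq_relIndex_of_coe_subset_mul`: `[𝒪^× : Λ^×] = [D¹ : D¹ ∩ Λ^×] = [D¹ : Λ¹]`; `D¹`, `Λ¹` hypothesis-characterised exactly as the RHS of
★ `mem_unitaryGroupOfForm_and_det_eq_one_iff` (existence: `exists_normOneGroups`). [cite: VignerasLNM800, Ch. II §4] [cite: Kottwitz1988, §2 Thm. 2] -/
theorem relIndex_normOne_eq [CompleteSpace K] [Finite 𝓀[K]] (hD : IsRamifiedQuadraticDatum σ ϖ d t) (h2 : Valued.v (2 : K) < 1)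
    {ξ : K} (hσξ : σ ξ = ξ) (hξ1 : Valued.v ξ = 1) (hξN : ¬ ∃ z : K, z * σ z = ξ)
    (SU SK : Subgroup (GL (Fin 2) K)) (hSU : ∀ g : GL (Fin 2) K, g ∈ SU ↔
      ∃ a b : K, (g : Matrix (Fin 2) (Fin 2) K) = !![a, ξ * b; σ b, σ a] ∧ a * σ a - ξ * (b * σ b) = 1)
    (hSK : ∀ g : GL (Fin 2) K, g ∈ SK ↔
      ∃ a b : K, (g : Matrix (Fin 2) (Fin 2) K) = !![a, ξ * b; σ b, σ a] ∧ a * σ a - ξ * (b * σ b) = 1 ∧ Valued.v a ≤ 1 ∧ Valued.v b ≤ 1) :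
    SK.relIndex SU = (Nat.card 𝓀[K] + 1) * Nat.card 𝓀[K] ^ (d - 2) := by
  obtain ⟨hσ, hvσ, -, -, -, -, -⟩ := id hD
  obtain ⟨UO, hUO⟩ := exists_unitGroup hσ hσξ
  obtain ⟨UΛ, hUΛ⟩ := exists_intUnitGroup hσ hvσ hσξ hξ1
  -- `Λ¹ = Λ^× ∩ D¹`, `D¹ ≤ 𝒪^×`
  have hSK' : SK = UΛ ⊓ SU := by
    ext g
    rw [hSK, Subgroup.mem_inf, hUΛ, hSU]
    constructor
    · rintro ⟨a, b, hg, hN, ha, hb⟩; exact ⟨⟨a, b, hg, by rw [hN, map_one], ha, hb⟩, ⟨a, b, hg, hN⟩⟩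
    · rintro ⟨⟨a, b, hg, -, ha, hb⟩, ⟨a', b', hg', hN'⟩⟩
      obtain ⟨rfl, rfl⟩ := quatMat_inj (σ := σ) (hg.symm.trans hg')
      exact ⟨a, b, hg, hN', ha, hb⟩
  have hSUO : SU ≤ UO := fun g hg => by
    obtain ⟨a, b, hg', hN⟩ := (hSU g).1 hg; exact (hUO g).2 ⟨a, b, hg', by rw [hN, map_one]⟩
  -- `𝒪^× ⊆ D¹ · Λ^×`: the reduced norm `τ` of `u ∈ 𝒪^×` is a fixed unit, hence `τ = nrd(λ)` with `λ ∈ Λ^×`; `u = (u λ⁻¹) · λ`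
  have hsub : (UO : Set (GL (Fin 2) K)) ⊆ (SU : Set (GL (Fin 2) K)) * (UΛ : Set (GL (Fin 2) K)) := by
    intro u hu
    obtain ⟨a, b, hg, hN⟩ := (hUO u).1 hu
    obtain ⟨a', b', ha', hb', hN'⟩ :=
      exists_integral_norm_sub_mul_norm_eq hD h2 hσξ hξ1 hξN (map_norm_sub_mul_norm hσ hσξ a b) hN
    have hdet : (!![a', ξ * b'; σ b', σ a']).det ≠ 0 := by
      rw [det_quatMat σ ξ, hN']; intro h0; rw [h0, map_zero] at hN; exact zero_ne_one hN
    set l : GL (Fin 2) K := Matrix.GeneralLinearGroup.mkOfDetNeZero _ hdet with hl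
    have hlv : (l : Matrix (Fin 2) (Fin 2) K) = !![a', ξ * b'; σ b', σ a'] := Matrix.GeneralLinearGroup.val_mkOfDetNeZero _ _
    have hlΛ : l ∈ UΛ := (hUΛ l).2 ⟨a', b', hlv, by rw [hN', hN], ha', hb'⟩
    have hs : u * l⁻¹ ∈ SU := by
      have hsO : u * l⁻¹ ∈ UO := UO.mul_mem hu (UO.inv_mem ((hUΛ l).1 hlΛ |>.elim fun a'' h => by
        obtain ⟨b'', hg'', hN'', -, -⟩ := h; exact (hUO l).2 ⟨a'', b'', hg'', hN''⟩))
      obtain ⟨a'', b'', hg'', -⟩ := (hUO _).1 hsO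
      refine (hSU _).2 ⟨a'', b'', hg'', ?_⟩
      have hdet' : ((u * l⁻¹ : GL (Fin 2) K) : Matrix (Fin 2) (Fin 2) K).det = 1 := by
        rw [Units.val_mul, Matrix.det_mul, Matrix.coe_units_inv, Matrix.det_nonsing_inv, hg, hlv, det_quatMat σ ξ, det_quatMat σ ξ, hN',
          Ring.mul_inverse_cancel _ (Ne.isUnit fun h0 => by rw [h0, map_zero] at hN; exact zero_ne_one hN)]
      rwa [hg'', det_quatMat σ ξ] at hdet'
    exact ⟨u * l⁻¹, hs, l, hlΛ, inv_mul_cancel_right u l⟩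
  rw [hSK', Subgroup.inf_relIndex_right, ← relIndex_eq_relIndex_of_coe_subset_mul hSUO hsub]
  exact relIndex_intUnitGroup_unitGroup hD h2 hσξ hξ1 hξN UO UΛ hUO hUΛ

end Datum

end Summit.HodgeConjecture.HodgeConjecture.Cruxes.H413.K2E3WildQuaternionUnitIndex

end
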